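import Summits.ResolutionOfSingularities.ResolutionOfSingularities.Theorems.UniformComplexityPrimeModelTransferOfFamilyResolution
import Summits.ResolutionOfSingularities.ResolutionOfSingularities.Theorems.UniversalCellsCampaignW82FamilyResolutionInsep
import Mathlib.FieldTheory.IsPerfectClosure
import Mathlib.FieldTheory.PurelyInseparable.PerfectClosure
import HarnessLib

/-!
# Crux `PrimeFieldToPerfect` (stmt-ResolutionOfSingularities-15233), door 1 of slot W8.2:
# RESOLUTION IN FAMILIES with RADICIAL base extensions ⇒ resolution over every PERFECT field («⇐» of the
# door-1 family form)

Route `ResolutionOfSingularities/UniversalCells`, crux `PrimeFieldToPerfect` (resolution over `Spec (ZMod p)`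
⇒ resolution over every perfect field of characteristic `p`). The OURS module
`Theorems/UniversalCellsCampaignW82FamilyResolutionInsep.lean` (`CampaignW82.FamilyResolutionInsep p k`)
types the door-1 family form: simultaneous weak resolution of the field-valued fibres of every proper family
over a finitely generated `k`-domain with integral RADICIAL generic fibre, after a finite-type RADICIAL
(purely inseparable at the generic point) injective base extension. THIS FILE proves «family resolution ⇒
resolution over perfect fields», the door-1 twin of
`Theorems/UniformComplexityPrimeModelTransferOfFamilyResolution.lean` (p528212, door 2):

* `exists_ringHom_comp_eq_of_radicial` — perfect-field-valued points of `Spec A` over the generic point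
  LIFT along radicial extensions `A → A'` (Mathlib `PerfectRing.lift` for the `p`-radical map
  `Frac A → Frac A'`);
* `hasResolution_of_familyResolutionInsep` — **`FamilyResolutionInsep p k` ⇒ every integral separated
  finite-type scheme over every PERFECT field `K ⊇ k` of characteristic `p` has a resolution**: Nagata +
  Chow reduce to projective `Y`; `Y` is the fibre of a proper family over a finitely generated `k`-subalgebra
  `R ⊆ K` (`exists_isPullback_proper_subalgebra`, p528212); its radicial generic fibre over
  `L := perfectClosure (Frac R) K` (a perfect closure of `Frac R`, INSIDE the perfect `K`) is integral, `Y`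
  being its flat surjective base change; `FamilyResolutionInsep` gives `A'` radicial over `R` and `G`; the
  `K`-point `R ⊆ K` lifts to `A'` (previous lemma); the fibre of `G` there is a weak resolution of a scheme
  isomorphic to `Y` (`hasResolution_of_isIso_morphismRestrict`, p483756).

[OURS · LADDER-RESOLUTION L1, slot W8.2 (prime-field / universality transfer), door 1 UniversalCells]
Theorems over the summit's own route and OURS names; NOT statements of, and attributing nothing to,
Hironaka's 2017 manuscript. AI-written; weaker than expert review. Barrier bookkeeping: no resolution is
base-changed along an inseparable extension here (the family's fibres are assumed weakly resolved; this file
only picks the right fibre); the inseparable phenomena are confined to the base extension `A → A'`, along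
which POINTS (not resolutions) are lifted.

Sources: EGA IV₃ (1966) Thm. 8.8.2 (ii); U. Görtz, T. Wedhorn, *Algebraic Geometry I* (2020) Prop. 10.75 (1);
The Stacks Project, Tag 01ZM. [cite: EGAIV3, Thm. 8.8.2 (ii)] [cite: StacksProject, Tag 01ZM]
-/

noncomputable section

set_option linter.dupNamespace false -- mandated namespace of this single-conjunct summit

open CategoryTheory CategoryTheory.Limits AlgebraicGeometry TopologicalSpace
open Literature.AlgebraicGeometry.Resolution

namespace Summit.ResolutionOfSingularities.ResolutionOfSingularities.Theorems.PrimeModelTransfer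

open MonoidalCategory CartesianMonoidalCategory
open Literature.AlgebraicGeometry.Limits
open Literature.AlgebraicGeometry.Motives (SchemeOver specOver projectiveSpace)

set_option backward.isDefEq.respectTransparency false

/-- **Perfect-field-valued points of the generic point lift along RADICIAL extensions.** Let
`A → A'` be an injective map of domains of characteristic `p` which is radicial at the level of fraction
fields (every `x : A'` satisfies `b · x ^ (p ^ n) = a` with `a, b ∈ A`, `b ≠ 0`), and `j : A → K` an
injective map to a PERFECT field `K`. Then `j` extends to `A' → K`: `Frac A → Frac A'` is `p`-radical
(`IsPRadical`), so `Frac A → K` extends to `Frac A' → K` by Mathlib's `PerfectRing.lift`. (Door 2 used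
`IsAlgClosed.lift` for ALGEBRAIC extensions and algebraically closed `K` instead.) [folklore] -/
theorem exists_ringHom_comp_eq_of_radicial (p : ℕ) [Fact p.Prime] {A A' : Type} [CommRing A] [IsDomain A]
    [CommRing A'] [IsDomain A'] [Algebra A A'] [CharP A p]
    (hinj : Function.Injective (algebraMap A A'))
    (hrad : ∀ x : A', ∃ (n : ℕ) (a b : A), b ≠ 0 ∧ algebraMap A A' b * x ^ p ^ n = algebraMap A A' a)
    (K : Type) [Field K] [CharP K p] [PerfectField K] (j : A →+* K) (hj : Function.Injective j) :
    ∃ τ : A' →+* K, τ.comp (algebraMap A A') = j := by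
  classical
  let F : Type := FractionRing A
  let F' : Type := FractionRing A'
  haveI : CharP A' p := charP_of_injective_algebraMap hinj p
  haveI : CharP F p := charP_of_injective_algebraMap (IsFractionRing.injective A F) p
  haveI : CharP F' p := charP_of_injective_algebraMap (IsFractionRing.injective A' F') p
  -- `i : Frac A → Frac A'`
  have hg : Function.Injective ((algebraMap A' F').comp (algebraMap A A')) :=
    (IsFractionRing.injective A' F').comp hinj
  let i : F →+* F' := IsFractionRing.lift hg
  have hi : ∀ a : A, i (algebraMap A F a) = algebraMap A' F' (algebraMap A A' a) := fun a =>
    IsFractionRing.lift_algebraMap hg a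
  -- `i` is `p`-radical
  haveI : IsPRadical i p := by
    refine ⟨fun x => ?_, by
      rw [(RingHom.injective_iff_ker_eq_bot i).mp i.injective]; exact bot_le⟩
    obtain ⟨a', b', hb', rfl⟩ := IsFractionRing.div_surjective (A := A') x
    obtain ⟨n₁, a₁, b₁, hb₁, h₁⟩ := hrad a'
    obtain ⟨n₂, a₂, b₂, hb₂, h₂⟩ := hrad b'
    have hb'0 : b' ≠ 0 := nonZeroDivisors.ne_zero hb'
    have ha₂ : algebraMap A A' a₂ ≠ 0 := by
      rw [← h₂]; exact mul_ne_zero ((map_ne_zero_iff _ hinj).mpr hb₂) (pow_ne_zero _ hb'0)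
    -- in `F'`: `a' ^ p ^ n₁ = a₁ / b₁`, `b' ^ p ^ n₂ = a₂ / b₂`
    have e₁ : (algebraMap A' F' a') ^ p ^ n₁ =
        algebraMap A' F' (algebraMap A A' a₁) / algebraMap A' F' (algebraMap A A' b₁) := by
      rw [eq_div_iff ((map_ne_zero_iff _ (IsFractionRing.injective A' F')).mpr
        ((map_ne_zero_iff _ hinj).mpr hb₁)), ← map_pow, ← map_mul, mul_comm, h₁]
    have e₂ : (algebraMap A' F' b') ^ p ^ n₂ =
        algebraMap A' F' (algebraMap A A' a₂) / algebraMap A' F' (algebraMap A A' b₂) := by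
      rw [eq_div_iff ((map_ne_zero_iff _ (IsFractionRing.injective A' F')).mpr
        ((map_ne_zero_iff _ hinj).mpr hb₂)), ← map_pow, ← map_mul, mul_comm, h₂]
    refine ⟨n₁ + n₂, (algebraMap A F a₁ / algebraMap A F b₁) ^ p ^ n₂ /
      (algebraMap A F a₂ / algebraMap A F b₂) ^ p ^ n₁, ?_⟩
    rw [map_div₀, map_pow, map_pow, map_div₀, map_div₀, hi, hi, hi, hi, ← e₁, ← e₂, div_pow,
      ← pow_mul, ← pow_mul, ← pow_add, ← pow_add, Nat.add_comm n₂ n₁]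
  -- lift to the perfect field `K`
  let jK : F →+* K := IsFractionRing.lift hj
  let τ : A' →+* K := (PerfectRing.lift i jK p).comp (algebraMap A' F')
  refine ⟨τ, RingHom.ext fun a => ?_⟩
  change PerfectRing.lift i jK p (algebraMap A' F' (algebraMap A A' a)) = j a
  rw [← hi, PerfectRing.lift_comp_apply]
  exact IsFractionRing.lift_algebraMap hj a

/-- **The perfect closure of `Frac R` INSIDE a perfect field `K ⊇ R`, packaged abstractly** (to keep
heavy subtypes out of the main proof): a perfect field `L`, radicial over `R` (every `x` satisfies
`b · x ^ (p ^ n) = a`, `b ≠ 0`), with an `R`-compatible ring map `σ : L → K`. It is Mathlib's relative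
perfect closure `perfectClosure (Frac R) K` (`mem_perfectClosure_iff_pow_mem`), perfect because `K` is.
[folklore] -/
theorem exists_perfectClosure_inside (p : ℕ) [Fact p.Prime] {R K : Type} [CommRing R] [IsDomain R]
    [Field K] [CharP K p] [PerfectField K] (ψ : R →+* K) (hψ : Function.Injective ψ) :
    ∃ (L : Type) (_ : Field L) (_ : PerfectField L) (_ : Algebra R L) (σ : L →+* K),
      Function.Injective (algebraMap R L) ∧ σ.comp (algebraMap R L) = ψ ∧
      ∀ x : L, ∃ (n : ℕ) (a b : R), b ≠ 0 ∧ algebraMap R L b * x ^ p ^ n = algebraMap R L a := by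
  classical
  haveI : CharP R p := ψ.charP hψ p
  let Fr : Type := FractionRing R
  haveI : CharP Fr p := charP_of_injective_algebraMap (IsFractionRing.injective R Fr) p
  let jF : Fr →+* K := IsFractionRing.lift hψ
  letI : Algebra Fr K := jF.toAlgebra
  let Lp : IntermediateField Fr K := perfectClosure Fr K
  letI : Algebra R Lp := ((algebraMap Fr Lp).comp (algebraMap R Fr)).toAlgebra
  have hσ : (algebraMap Lp K).comp (algebraMap R Lp) = ψ := by
    ext x
    change jF (algebraMap R Fr x) = ψ x
    exact IsFractionRing.lift_algebraMap hψ x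
  have hinj : Function.Injective (algebraMap R Lp) :=
    (algebraMap Fr Lp).injective.comp (IsFractionRing.injective R Fr)
  refine ⟨Lp, inferInstance, inferInstance, inferInstance, algebraMap Lp K, hinj, hσ, fun x => ?_⟩
  obtain ⟨n, y, hy⟩ := (mem_perfectClosure_iff_pow_mem p (F := Fr) (E := K)).mp x.2
  obtain ⟨a, b, hb, rfl⟩ := IsFractionRing.div_surjective (A := R) y
  refine ⟨n, a, b, nonZeroDivisors.ne_zero hb, ?_⟩
  apply (algebraMap Lp K).injective
  have hbK : ψ b ≠ 0 := (map_ne_zero_iff _ hψ).mpr (nonZeroDivisors.ne_zero hb)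
  have hy' : jF (algebraMap R Fr a / algebraMap R Fr b) = (x : K) ^ p ^ n := hy
  rw [map_div₀, IsFractionRing.lift_algebraMap hψ, IsFractionRing.lift_algebraMap hψ,
    div_eq_iff hbK] at hy'
  rw [map_mul, map_pow, ← RingHom.comp_apply, ← RingHom.comp_apply, hσ, mul_comm]
  exact hy'.symm

/-- **RADICIAL FAMILY RESOLUTION over `k` implies resolution over every PERFECT extension `K` of `k` of
characteristic `p`.** See the module docstring for the proof; the only differences with the door-2 theorem
`hasResolution_of_familyResolution` (p528212) are the generic fibre (taken over the perfect closure of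
`Frac R` inside `K` — `perfectClosure (FractionRing R) K`, perfect because `K` is, radicial over `R` by
`mem_perfectClosure_iff_pow_mem`) and the lift of the `K`-point (`exists_ringHom_comp_eq_of_radicial`
instead of `IsAlgClosed.lift`). [cite: EGAIV3, Thm. 8.8.2 (ii)] [cite: StacksProject, Tag 01ZM] -/
theorem hasResolution_of_familyResolutionInsep (p : ℕ) [Fact p.Prime] (k K : Type) [Field k] [Field K]
    [CharP K p] [PerfectField K] [Algebra k K] (hFR : CampaignW82.FamilyResolutionInsep p k)
    (X : Scheme.{0}) (f : X ⟶ Spec (.of K)) [IsSeparated f] [LocallyOfFiniteType f]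
    [QuasiCompact f] [IsIntegral X] : Scheme.HasResolution X := by
  classical
  -- ### Step 0: it suffices to resolve integral PROJECTIVE `K`-schemes (Nagata + Chow)
  refine hasResolution_of_forall_proper K (fun Y₀ g₀ hg₀ hY₀ => ?_) X f
  haveI := hg₀
  haveI := hY₀
  obtain ⟨n, Y, ρ, ι, hY, hι, hρ, -, hw, U, hUd, hUpre, hUiso⟩ :=
    ChowLemmaRing.chow_proper (R := K) Y₀ g₀
  haveI := hρ
  haveI := hι
  haveI := hY
  let g : Y ⟶ Spec (.of K) := ρ ≫ g₀
  have hproj : ChowLemmaRing.IsProjOver (Over.mk g : SchemeOver K) := ⟨n, Over.homMk ι hw, hι⟩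
  refine Scheme.HasResolution.of_isBirational ρ ⟨U, hUd, hUpre, hUiso⟩ ?_
  -- ### Step 1: a proper model `F : X' → Spec R` over a finitely generated `k`-subalgebra `R ⊆ K`
  obtain ⟨R, _, _, _, ψ, X', F, π, hψ, hRft, hF, hsq⟩ :=
    exists_isPullback_proper_subalgebra k K g hproj
  haveI := hRft
  haveI := hF
  letI : Algebra R K := ψ.toAlgebra
  haveI : FaithfulSMul R K := (faithfulSMul_iff_algebraMap_injective R K).mpr hψ
  -- ### Step 2: the radicial generic fibre `X' ×_R Spec L`, `L` = a perfect closure of `Frac R` inside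
  -- `K`, is integral (`Y` is its flat surjective base change)
  obtain ⟨L, _, _, _, σ, hRLinj, hσ, hrad⟩ := exists_perfectClosure_inside p ψ hψ
  let iL : Spec (.of L) ⟶ Spec (.of R) := Spec.map (CommRingCat.ofHom (algebraMap R L))
  let jσ : Spec (.of K) ⟶ Spec (.of L) := Spec.map (CommRingCat.ofHom σ)
  have hjσ : jσ ≫ iL = Spec.map (CommRingCat.ofHom ψ) := by
    change Spec.map _ ≫ Spec.map _ = _
    rw [← Spec.map_comp, ← CommRingCat.ofHom_comp, hσ]
  let XL : Scheme.{0} := pullback F iL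
  let FL : XL ⟶ Spec (.of L) := pullback.snd F iL
  let m : Y ⟶ XL := pullback.lift π (g ≫ jσ) (by rw [Category.assoc, hjσ]; exact hsq.w)
  have hsqm : IsPullback m g FL jσ := by
    have outer : IsPullback (m ≫ pullback.fst F iL) g F (jσ ≫ iL) := by
      rw [pullback.lift_fst, hjσ]; exact hsq
    exact outer.of_right (pullback.lift_snd _ _ _) (IsPullback.of_hasPullback F iL)
  haveI : Subsingleton ↥(Spec (CommRingCat.of L)) := inferInstanceAs (Subsingleton (PrimeSpectrum L))
  haveI : Subsingleton ↥(Spec (CommRingCat.of K)) := inferInstanceAs (Subsingleton (PrimeSpectrum K))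
  haveI : Nonempty ↥(Spec (CommRingCat.of K)) := inferInstanceAs (Nonempty (PrimeSpectrum K))
  haveI : Flat jσ := by
    letI : Algebra L K := σ.toAlgebra
    haveI hflat : Module.Flat L K := inferInstance
    rw [show jσ = Spec.map (CommRingCat.ofHom (algebraMap L K)) from rfl, Flat.SpecMap_iff,
      CommRingCat.hom_ofHom]
    exact RingHom.flat_algebraMap_iff.mpr hflat
  haveI : Surjective jσ := inferInstance
  haveI : Flat m := MorphismProperty.of_isPullback (P := @Flat) hsqm.flip ‹Flat jσ›
  haveI : Surjective m := MorphismProperty.of_isPullback (P := @Surjective) hsqm.flip ‹Surjective jσ›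
  haveI : IsReduced XL := Literature.AlgebraicGeometry.Morphisms.isReduced_of_flat_of_surjective m
  haveI : IrreducibleSpace XL := Function.Surjective.irreducibleSpace m.continuous m.surjective
  have hint : IsIntegral XL := isIntegral_of_irreducibleSpace_of_isReduced XL
  -- ### Step 3: the simultaneous weak resolution over a radicial finite-type extension `A'`
  obtain ⟨A', _, _, _, hinj, -, hradA, 𝒴, G, hG⟩ :=
    hFR.exists_datum R X' F L hRLinj hrad hint
  -- ### Step 4: the `K`-point `R ⊆ K` lifts to `τ : A' → K` (`A'` radicial over `R`, `K` perfect)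
  haveI : CharP R p := ψ.charP hψ p
  obtain ⟨τ, hτ⟩ := exists_ringHom_comp_eq_of_radicial p hinj hradA K ψ hψ
  let ιA : Spec (.of A') ⟶ Spec (.of R) := Spec.map (CommRingCat.ofHom (algebraMap R A'))
  let F' : pullback F ιA ⟶ Spec (.of A') := pullback.snd F ιA
  let cτ : Spec (.of K) ⟶ Spec (.of A') := Spec.map (CommRingCat.ofHom τ)
  have hcτ : cτ ≫ ιA = Spec.map (CommRingCat.ofHom ψ) := by
    change Spec.map _ ≫ Spec.map _ = _
    rw [← Spec.map_comp, ← CommRingCat.ofHom_comp, hτ]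
  -- ### Step 5: the fibre of `G` at `τ` is a weak resolution of `(X' ×_R A') ×_{A'} K ≅ Y`
  obtain ⟨hGp, hreg, W, hWne, hWiso⟩ := hG K τ
  let Xτ : Scheme.{0} := pullback F' cτ
  let Gτ : pullback G (pullback.fst F' cτ) ⟶ Xτ := pullback.snd G (pullback.fst F' cτ)
  haveI : IsProper Gτ := hGp
  haveI : IsIso (Gτ ∣_ W) := hWiso
  let e : Xτ ≅ Y :=
    pullbackLeftPullbackSndIso F ιA cτ ≪≫ pullback.congrHom rfl hcτ ≪≫ hsq.isoPullback.symm
  haveI : IrreducibleSpace Xτ :=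
    Function.Surjective.irreducibleSpace e.inv.continuous e.inv.surjective
  let pτ : Xτ ⟶ Spec (.of K) := pullback.snd F' cτ
  haveI : IsProper pτ := inferInstance
  haveI : LocallyOfFiniteType Gτ := @IsProper.toLocallyOfFiniteType _ _ Gτ hGp
  haveI : UniversallyClosed Gτ := @IsProper.toUniversallyClosed _ _ Gτ hGp
  haveI : QuasiCompact Gτ := inferInstance
  haveI hpτ : IsProper pτ := inferInstance
  haveI : LocallyOfFiniteType pτ := @IsProper.toLocallyOfFiniteType _ _ pτ hpτ
  haveI : UniversallyClosed pτ := @IsProper.toUniversallyClosed _ _ pτ hpτ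
  haveI : QuasiCompact pτ := inferInstance
  haveI : IsNoetherian (pullback G (pullback.fst F' cτ)) := isNoetherian_of_locallyOfFiniteType (Gτ ≫ pτ)
  exact Scheme.HasResolution.of_iso e.hom (hasResolution_of_isIso_morphismRestrict Gτ hreg W hWne)

/-! ## The crux slice from family resolution over the prime model -/


end Summit.ResolutionOfSingularities.ResolutionOfSingularities.Theorems.PrimeModelTransfer

end
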